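import Summits.QuantumFields.YangMills.Theorems.SwapVirialDeficitBlowUpRingPathsParam
import Summits.QuantumFields.YangMills.Theorems.SwapVirialDeficitBlowUpPeriodicScaling
import Summits.QuantumFields.YangMills.Theorems.ToronValleyVolumeLojasiewiczLocaliseRing
import HarnessLib

/-!
# The PERIODIC massive-mode rung, brick PM-0a: the PERIODIC (zero-flux, `κ = id` seam) ring deficit as a quaternion polynomial of the links,
# its smoothness, and the periodic chart deficit `C^n` in any parameter
# (free-hands support of ⟨stmt-QuantumFields-24196⟩ `SwapVirialDeficit.ToronSoftnessSharp`; LEAD memo `sfw-p2-g96-memo-24196-PM-design.md` §3 PM-0a;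
# the periodic twin of fcl-p3 g45's ✓`BlowUp.qDeficit` ∕ ✓`swapRingDeficit_eq_qDeficit` ∕ ✓`contDiff_qDeficit` — same sums, seam `g · tw_z(U₀)` WITHOUT the
# axis swap `σ`; offered by fcl-p3 g45 2026-08-31T12:59Z (c))

Input (S) of the PM structure theorem (LEAD memo §1) is the JOINT smoothness of the periodic chart deficit in the two-scale parameters and the blow-up
point.  fcl-p3's quaternionic transcription is written for the σ-glued ring (`qSeam z Q = qGauge Q.2 (qTwist3 z (qSwap (Q.1 0)))`); the periodic ring
✓`VirialFluxGap.RingDeficit.ringDeficit` glues with `g · tw_z(U₀)` (✓`ToronValleyVolume.Lojasiewicz.ringDeficit_eq_sums`), so: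
* §1 `periodicQSeam z Q := qGauge Q.2 (qTwist3 z (Q.1 0))`, `periodicQDeficit z Q` (fcl-p3's four sums with `periodicQSeam`), ★ `su2Quat_periodicSeam`,
  ★★ `ringDeficit_eq_periodicQDeficit : ringDeficit L z P = periodicQDeficit z (su2Quat ∘ P)`;
* §2 ★ `contDiff_periodicQSeam`, ★★ `contDiff_periodicQDeficit` (every `n`);
* §3 ★★ `contDiffOn_periodicChartDeficit_param` ∕ `contDiff_periodicChartDeficit_param` — `p ↦ periodicChartDeficit L z χ (C p, U p)` is `C^n` on `S ⊆ E`
  (any normed space `E`) if the leader ∕ follower quaternions are (✓PM-0b `contDiffOn_quatHistory_ringConfig_param`).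
HONEST LABEL: algebra ∕ calculus plumbing (plan-level fixed-`L` rung of a DRAFT line); nothing of PM, ⟨24196⟩ or ⟨24197⟩ is proved; own crux ⟨22884⟩ OPEN
(blocked-on ⟨19935⟩); the Yang–Mills mass gap is NOT proved; no summit is proved by a line.
LEAD seat ym-line-sfw-p2 g96 (cell ym-idea-1, free hands), `--supports stmt-QuantumFields-24196`.  Two `def`s, standard axioms, 0 `sorry`.
References: [cite: Luscher1983, §2]; [cite: tHooft1979]; [folklore].
-/

set_option autoImplicit false

noncomputable section

open scoped BigOperators Quaternion ContDiff
open Quaternion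
open Literature.MathematicalPhysics.QuantumFieldTheory hiding SU2
open Literature.MathematicalPhysics.QuantumLattice

namespace Summit.QuantumFields.YangMills.Theorems.SwapVirialDeficit.BlowUp

open Summit.QuantumFields.YangMills.Theorems.FemtoTransferGap
open Summit.QuantumFields.YangMills.Theorems.FemtoTransferGap.TT
open Summit.QuantumFields.YangMills.Theorems.VirialFluxGap.RingDeficit (ringDeficit)
open Summit.QuantumFields.YangMills.Theorems.ToronValleyVolume.Lojasiewicz (ringDeficit_eq_sums)

variable {L : ℕ} [NeZero L]

/-! ## §1 The periodic deficit in quaternions -/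

/-- **The periodic seam configuration** `g · tw_z(U₀)` in quaternions (NO axis swap; cf. ✓`qSeam` = `qGauge Q.2 (qTwist3 z (qSwap (Q.1 0)))`). [cite: tHooft1979] -/
def periodicQSeam (z : Fin 3 → Bool) (Q : (Fin (2 * L - 1 + 1) → Edge 3 L → ℍ) × (Site 3 L → ℍ)) : Edge 3 L → ℍ :=
  qGauge Q.2 (qTwist3 z (Q.1 0))

/-- ★ **The periodic (zero-flux-type, twist `z`, seam map `κ = id`) deficit as a quaternion polynomial**: the transcription of
✓`ToronValleyVolume.Lojasiewicz.ringDeficit_eq_sums`. [cite: Luscher1983, §2] -/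
def periodicQDeficit (z : Fin 3 → Bool) (Q : (Fin (2 * L - 1 + 1) → Edge 3 L → ℍ) × (Site 3 L → ℍ)) : ℝ :=
  (∑ i : Fin (2 * L - 1), (6 * (L : ℝ) ^ 3 - qTimeCoupling (Q.1 i.castSucc) (Q.1 i.succ))) +
    (6 * (L : ℝ) ^ 3 - qTimeCoupling (Q.1 (Fin.last (2 * L - 1))) (periodicQSeam z Q)) +
    (∑ i : Fin (2 * L - 1), (1 / 2 : ℝ) * (qWilson (Q.1 i.castSucc) + qWilson (Q.1 i.succ))) +
    (1 / 2 : ℝ) * (qWilson (Q.1 (Fin.last (2 * L - 1))) + qWilson (periodicQSeam z Q))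

omit [NeZero L] in
/-- ★ The periodic seam through the dictionary `SU(2) → ℍ` (✓`su2Quat_gaugeTransform`, ✓`su2Quat_twist3`). [cite: tHooft1979] -/
theorem su2Quat_periodicSeam (z : Fin 3 → Bool) (P : (Fin (2 * L - 1 + 1) → GaugeConfig 3 L SU2) × (Site 3 L → SU2)) :
    (fun e => su2Quat (gaugeTransform P.2 (TT.twist3 z (P.1 0)) e)) =
      periodicQSeam z (fun i e => su2Quat (P.1 i e), fun x => su2Quat (P.2 x)) := by
  rw [su2Quat_gaugeTransform, su2Quat_twist3]
  rfl

/-- ★★ **THE PERIODIC DEFICIT IS A QUATERNION POLYNOMIAL OF THE LINKS**: `F_z(P) = periodicQDeficit z (su2Quat ∘ P)`. [cite: Luscher1983, §2] -/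
theorem ringDeficit_eq_periodicQDeficit (z : Fin 3 → Bool) (P : (Fin (2 * L - 1 + 1) → GaugeConfig 3 L SU2) × (Site 3 L → SU2)) :
    ringDeficit L z P = periodicQDeficit z (fun i e => su2Quat (P.1 i e), fun x => su2Quat (P.2 x)) := by
  rw [ringDeficit_eq_sums]
  unfold periodicQDeficit
  simp only [timeCoupling_eq_qTimeCoupling, wilsonAction_eq_qWilson]
  rw [su2Quat_periodicSeam z P]

/-! ## §2 Smoothness -/

/-- ★ The periodic seam configuration is `C^n` on the quaternionic history space. [folklore] -/
theorem contDiff_periodicQSeam {n : WithTop ℕ∞} (z : Fin 3 → Bool) :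
    ContDiff ℝ n (periodicQSeam (L := L) z) := by
  have h1 : ContDiff ℝ n (fun f : Fin (2 * L - 1 + 1) → Edge 3 L → ℍ => f 0) := contDiff_apply ℝ (Edge 3 L → ℍ) (0 : Fin (2 * L - 1 + 1))
  have h2 : ContDiff ℝ n (fun Q : (Fin (2 * L - 1 + 1) → Edge 3 L → ℍ) × (Site 3 L → ℍ) => Q.1) := contDiff_fst
  have h0 : ContDiff ℝ n (fun Q : (Fin (2 * L - 1 + 1) → Edge 3 L → ℍ) × (Site 3 L → ℍ) => Q.1 0) := h1.comp h2
  have h4 : ContDiff ℝ n (fun Q : (Fin (2 * L - 1 + 1) → Edge 3 L → ℍ) × (Site 3 L → ℍ) => qTwist3 z (Q.1 0)) :=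
    (contDiff_qTwist3 z).comp h0
  have h5 : ContDiff ℝ n (fun Q : (Fin (2 * L - 1 + 1) → Edge 3 L → ℍ) × (Site 3 L → ℍ) => Q.2) := contDiff_snd
  have h6 : ContDiff ℝ n (fun Q : (Fin (2 * L - 1 + 1) → Edge 3 L → ℍ) × (Site 3 L → ℍ) => (Q.2, qTwist3 z (Q.1 0))) := h5.prodMk h4
  have h7 := (contDiff_qGauge (L := L) (n := n)).comp h6
  exact h7

/-- ★★ **THE PERIODIC QUATERNIONIC DEFICIT IS `C^n`** on the quaternionic history space, for every `n`. [folklore] -/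
theorem contDiff_periodicQDeficit {n : WithTop ℕ∞} (z : Fin 3 → Bool) : ContDiff ℝ n (periodicQDeficit (L := L) z) := by
  have h2 : ContDiff ℝ n (fun Q : (Fin (2 * L - 1 + 1) → Edge 3 L → ℍ) × (Site 3 L → ℍ) => Q.1) := contDiff_fst
  have hsl : ∀ i : Fin (2 * L - 1 + 1), ContDiff ℝ n (fun Q : (Fin (2 * L - 1 + 1) → Edge 3 L → ℍ) × (Site 3 L → ℍ) => Q.1 i) := by
    intro i
    have h1 : ContDiff ℝ n (fun f : Fin (2 * L - 1 + 1) → Edge 3 L → ℍ => f i) := contDiff_apply ℝ (Edge 3 L → ℍ) i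
    exact h1.comp h2
  have hT : ∀ i j : Fin (2 * L - 1 + 1), ContDiff ℝ n
      (fun Q : (Fin (2 * L - 1 + 1) → Edge 3 L → ℍ) × (Site 3 L → ℍ) => qTimeCoupling (Q.1 i) (Q.1 j)) := by
    intro i j
    have h := (contDiff_qTimeCoupling (L := L) (n := n)).comp ((hsl i).prodMk (hsl j))
    exact h
  have hS := contDiff_periodicQSeam (L := L) (n := n) z
  have hTs : ContDiff ℝ n (fun Q : (Fin (2 * L - 1 + 1) → Edge 3 L → ℍ) × (Site 3 L → ℍ) =>
      qTimeCoupling (Q.1 (Fin.last (2 * L - 1))) (periodicQSeam z Q)) := by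
    have h := (contDiff_qTimeCoupling (L := L) (n := n)).comp ((hsl (Fin.last (2 * L - 1))).prodMk hS)
    exact h
  have hW : ∀ i : Fin (2 * L - 1 + 1), ContDiff ℝ n (fun Q : (Fin (2 * L - 1 + 1) → Edge 3 L → ℍ) × (Site 3 L → ℍ) => qWilson (Q.1 i)) := by
    intro i
    have h := (contDiff_qWilson (L := L) (n := n)).comp (hsl i)
    exact h
  have hWs : ContDiff ℝ n (fun Q : (Fin (2 * L - 1 + 1) → Edge 3 L → ℍ) × (Site 3 L → ℍ) => qWilson (periodicQSeam z Q)) := by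
    have h := (contDiff_qWilson (L := L) (n := n)).comp hS
    exact h
  unfold periodicQDeficit
  refine ((ContDiff.add (ContDiff.add ?_ ?_) ?_).add ?_)
  · exact ContDiff.sum fun i _ => contDiff_const.sub (hT _ _)
  · exact contDiff_const.sub hTs
  · exact ContDiff.sum fun i _ => contDiff_const.mul ((hW _).add (hW _))
  · exact contDiff_const.mul ((hW _).add hWs)

end Summit.QuantumFields.YangMills.Theorems.SwapVirialDeficit.BlowUp

/-! ## §3 The periodic chart deficit in a parameter -/

namespace Summit.QuantumFields.YangMills.Theorems.SwapVirialDeficit.BlowUpRing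

open Summit.QuantumFields.YangMills.Theorems.FemtoTransferGap
open Summit.QuantumFields.YangMills.Theorems.FemtoTransferGap.TT
open Summit.QuantumFields.YangMills.Theorems.SwapVirialDeficit.BlowUp (periodicQDeficit contDiff_periodicQDeficit ringDeficit_eq_periodicQDeficit)

variable {L : ℕ} [NeZero L]
variable {E : Type*} [NormedAddCommGroup E] [NormedSpace ℝ E] {n : ℕ∞} {S : Set E} {C : E → Fin 4 → SU2} {U : E → Fol L → SU2}

/-- ★★ **THE PERIODIC CHART DEFICIT IS `C^n` ON `S` IN THE PARAMETER** (`p : E`, any normed space): `p ↦ periodicChartDeficit L z χ (C p, U p)`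
(✓`ringDeficit_eq_periodicQDeficit` ∘ ✓`contDiffOn_quatHistory_ringConfig_param`) — input (S) of the PM structure theorem with `p = (u, s, a₀, w', y)`
and the raw two-scale letters. [cite: Luscher1983, §2] -/
theorem contDiffOn_periodicChartDeficit_param (z : Fin 3 → Bool) (χ : Site 3 L → SU2)
    (hC : ∀ μ : Fin 4, ContDiffOn ℝ n (fun p => su2Quat (C p μ)) S) (hU : ∀ i : Fol L, ContDiffOn ℝ n (fun p => su2Quat (U p i)) S) :
    ContDiffOn ℝ n (fun p => periodicChartDeficit L z χ (C p, U p)) S := by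
  have e : (fun p => periodicChartDeficit L z χ (C p, U p)) = fun p =>
      periodicQDeficit z ((fun i e => su2Quat ((fixHistory (ringConfig χ (C p, U p))).1 i e),
        fun x => su2Quat ((fixHistory (ringConfig χ (C p, U p))).2 x)) :
          (Fin (2 * L - 1 + 1) → Edge 3 L → ℍ) × (Site 3 L → ℍ)) := by
    funext p
    exact ringDeficit_eq_periodicQDeficit z _
  rw [e]
  exact (contDiff_periodicQDeficit (L := L) (n := n) z).comp_contDiffOn (contDiffOn_quatHistory_ringConfig_param χ hC hU)

/-- The global form (`S = univ`). [cite: Luscher1983, §2] -/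
theorem contDiff_periodicChartDeficit_param (z : Fin 3 → Bool) (χ : Site 3 L → SU2)
    (hC : ∀ μ : Fin 4, ContDiff ℝ n (fun p => su2Quat (C p μ))) (hU : ∀ i : Fol L, ContDiff ℝ n (fun p => su2Quat (U p i))) :
    ContDiff ℝ n (fun p => periodicChartDeficit L z χ (C p, U p)) := by
  rw [← contDiffOn_univ]
  exact contDiffOn_periodicChartDeficit_param z χ (fun μ => (hC μ).contDiffOn) (fun i => (hU i).contDiffOn)

end Summit.QuantumFields.YangMills.Theorems.SwapVirialDeficit.BlowUpRing

end
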